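import Literature.NumberTheory.Sieve.MoebiusShiftedPrimesMeanSquareTools
import HarnessLib

/-!
# Möbius on shifted primes — tools for Proposition 3.4, II: truncation at `2Y + h₂`

Topic `Literature/NumberTheory/Sieve`, companion of `MoebiusShiftedPrimesMeanSquareTools.lean`
(the analytic skeleton of "Proof of Proposition 3.4 from Proposition 5.1", J. D. Lichtman,
arXiv:2009.08969 [Lichtman2020], p. 14).

The skeleton `Lichtman2020.meanSquare_le_of_pieces` of that file feeds the Parseval polynomial
`A(s) = ∑_{Y ≤ m ≤ 4Y} a_m m^{-s}` of Lemma 4.6 with the two Proposition-5.1 polynomials at the scales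
`Y` and `2Y`.  The corrected Proposition 5.1 of the tree (`Lichtman2020_dirichletMeanValueWith`,
`MoebiusShiftedPrimesTypical.lean`) is recorded for the scales `Y ≤ X` only, so the scale `2Y ≤ 2X`
is not available.  This file removes it: the windows `[x, x + h_j]`, `x ≤ 2Y`, never see
`m > 2Y + h₂`, so the sequence may be TRUNCATED there (`truncPred`), after which
`A = G_Y + (tail over (2Y, 2Y + h₂ + 1]) - (overlap)`, and the tail — at most `3h₂` coefficients of
size `≤ 1/(2Y)` — is handled by the mean value theorem (Lemma 4.1) alone, contributing `O(h₂/Y)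
= O(T₀⁻³)`.

* `Lichtman2020.truncPred p M₂` — DEFINITION (glue): the predicate `p m ∧ m ≤ M₂`.
* `Lichtman2020.meanSquare_le_of_pieces_trunc` — the skeleton with only the two scale-`Y` piece
  bounds (for `c` and `c̄`):
  `∫_Y^{2Y} |S_h|² ≤ 24·2431² h² Y (2000/T₀² + 36 C₅ (Q/h + 1) L + 2000/h + 4/Y) + 2 (h/h₂)² η² Y`.

## Source

* J. D. Lichtman, arXiv:2009.08969, §5, proof of Proposition 3.4, (5.4)–(5.6), p. 14; Lemma 4.1
  p. 12 (the tree's `Literature.NumberTheory.LFunctions.dirichletPolynomial_meanSquare_le`).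
-/

noncomputable section

open MeasureTheory Finset Filter
open Literature.NumberTheory.LFunctions.WindowPlancherel

namespace Literature.NumberTheory.Sieve

namespace Lichtman2020

open MatomakiRadziwillL14

/-! ### Truncation -/

/-- The truncated predicate `p m ∧ m ≤ M₂`. [folklore] -/
def truncPred (p : ℕ → Prop) (M₂ : ℕ) (m : ℕ) : Prop := p m ∧ m ≤ M₂

/-- Decidability of `truncPred`. [folklore] -/
instance truncPred.decidablePred (p : ℕ → Prop) [DecidablePred p] (M₂ : ℕ) :
    DecidablePred (truncPred p M₂) := fun m => by unfold truncPred; infer_instance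

/-- Below the truncation point the truncated sums are the original ones. [folklore] -/
theorem sum_filter_truncPred_eq (p : ℕ → Prop) [DecidablePred p] (_c : ℕ → ℂ) {R : Finset ℕ}
    {M₂ : ℕ} (hR : ∀ m ∈ R, m ≤ M₂) (f : ℕ → ℂ) :
    ∑ m ∈ R.filter (truncPred p M₂), f m = ∑ m ∈ R.filter p, f m := by
  congr 1
  exact Finset.filter_congr fun m hm => ⟨fun h => h.1, fun h => ⟨h, hR m hm⟩⟩

/-- `⌊a + b⌋ ≤ ⌊a⌋ + ⌊b⌋ + 1` for `a, b ≥ 0`. [folklore] -/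
theorem floor_add_le_floor_add_floor_add_one {a b : ℝ} (ha : 0 ≤ a) (hb : 0 ≤ b) :
    ⌊a + b⌋₊ ≤ ⌊a⌋₊ + ⌊b⌋₊ + 1 := by
  have h1 := Nat.lt_floor_add_one a
  have h2 := Nat.lt_floor_add_one b
  have h3 : a + b < ((⌊a⌋₊ + ⌊b⌋₊ + 1 + 1 : ℕ) : ℝ) := by push_cast; linarith
  exact Nat.lt_succ_iff.1 ((Nat.floor_lt (by linarith)).2 h3)

/-! ### The tail polynomial: mean value theorem only -/

/-- The tail coefficients: at most `M₂ + 1 - ⌈2Y⌉ ≤ 3h₂` of them, each `≤ 1/(2Y)` in size, so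
`∑ |c'_n|² ≤ h₂/Y²` (`M₂ ≤ 2Y + h₂ + 1`, `h₂ ≥ 1`, `Y ≥ 1`). [folklore] -/
theorem sum_norm_sq_coeff_tail_le {Y h₂ : ℝ} (hY : 1 ≤ Y) (hh₂ : 1 ≤ h₂) (p : ℕ → Prop)
    [DecidablePred p] {c : ℕ → ℂ} (hc : ∀ n, ‖c n‖ ≤ 1) {M₂ N : ℕ} (hM₂ : (M₂ : ℝ) ≤ 2 * Y + h₂ + 1) :
    ∑ n ∈ Finset.Icc 1 N,
        ‖(if n ∈ (Finset.Icc ⌈2 * Y⌉₊ ⌊4 * Y⌋₊).filter (truncPred p M₂) then c n / n else 0 : ℂ)‖ ^ 2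
      ≤ h₂ / Y ^ 2 := by
  have hY0 : 0 < Y := by linarith
  set R := (Finset.Icc ⌈2 * Y⌉₊ ⌊4 * Y⌋₊).filter (truncPred p M₂) with hRdef
  have hRsub : R ⊆ Finset.Icc ⌈2 * Y⌉₊ M₂ := by
    intro n hn
    rw [hRdef, Finset.mem_filter, Finset.mem_Icc] at hn
    exact Finset.mem_Icc.2 ⟨hn.1.1, hn.2.2⟩
  have hterm : ∀ n ∈ Finset.Icc 1 N, ‖(if n ∈ R then c n / n else 0 : ℂ)‖ ^ 2
      ≤ if n ∈ R then 1 / (2 * Y) ^ 2 else 0 := by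
    intro n _
    by_cases hnR : n ∈ R
    · rw [if_pos hnR, if_pos hnR]
      have hn2 : 2 * Y ≤ n := by
        have := (Finset.mem_Icc.1 (hRsub hnR)).1
        exact (Nat.le_ceil _).trans (by exact_mod_cast this)
      have hn0 : (0 : ℝ) < n := by linarith
      rw [norm_div, Complex.norm_natCast, div_pow]
      calc ‖c n‖ ^ 2 / (n : ℝ) ^ 2 ≤ 1 / (n : ℝ) ^ 2 := by
            gcongr
            calc ‖c n‖ ^ 2 ≤ 1 ^ 2 := pow_le_pow_left₀ (norm_nonneg _) (hc n) 2
              _ = 1 := one_pow 2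
        _ ≤ 1 / (2 * Y) ^ 2 := by gcongr
    · rw [if_neg hnR, if_neg hnR]; simp
  have hcard : (#R : ℝ) ≤ 3 * h₂ := by
    have h1 : #R ≤ M₂ + 1 - ⌈2 * Y⌉₊ := (Finset.card_le_card hRsub).trans (by rw [Nat.card_Icc])
    have h2 : ((M₂ + 1 - ⌈2 * Y⌉₊ : ℕ) : ℝ) ≤ 3 * h₂ := by
      rcases le_or_gt ⌈2 * Y⌉₊ (M₂ + 1) with h3 | h3
      · rw [Nat.cast_sub h3]
        push_cast
        have := Nat.le_ceil (2 * Y)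
        linarith
      · rw [Nat.sub_eq_zero_of_le h3.le]; push_cast; linarith
    exact le_trans (by exact_mod_cast h1) h2
  calc ∑ n ∈ Finset.Icc 1 N, ‖(if n ∈ R then c n / n else 0 : ℂ)‖ ^ 2
      ≤ ∑ n ∈ Finset.Icc 1 N, (if n ∈ R then 1 / (2 * Y) ^ 2 else 0 : ℝ) := Finset.sum_le_sum hterm
    _ = #(Finset.Icc 1 N ∩ R) * (1 / (2 * Y) ^ 2) := by
        rw [Finset.sum_ite_mem, Finset.sum_const, nsmul_eq_mul]
    _ ≤ #R * (1 / (2 * Y) ^ 2) := by gcongr; exact Finset.inter_subset_right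
    _ ≤ 3 * h₂ * (1 / (2 * Y) ^ 2) := by gcongr
    _ = (3 / 4) * (h₂ / Y ^ 2) := by field_simp; ring
    _ ≤ h₂ / Y ^ 2 := by
        have : 0 ≤ h₂ / Y ^ 2 := by positivity
        linarith

/-- **Lemma 4.1 for the tail**: `∫_{-T}^{T} |tail(1+it)|² ≤ (5T + 18⌊4Y⌋) h₂/Y²`. [cite: Lichtman2020, Lemma 4.1] -/
theorem integral_norm_sq_tailPoly_le {Y h₂ : ℝ} (hY : 1 ≤ Y) (hh₂ : 1 ≤ h₂) (p : ℕ → Prop)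
    [DecidablePred p] {c : ℕ → ℂ} (hc : ∀ n, ‖c n‖ ≤ 1) {M₂ : ℕ} (hM₂ : (M₂ : ℝ) ≤ 2 * Y + h₂ + 1)
    {T : ℝ} (hT : 0 < T) :
    ∫ t in -T..T, ‖piecePoly (truncPred p M₂) c (Finset.Icc ⌈2 * Y⌉₊ ⌊4 * Y⌋₊) t‖ ^ 2 ≤
      (5 * T + 18 * (⌊4 * Y⌋₊ : ℕ)) * (h₂ / Y ^ 2) := by
  have hY0 : 0 < Y := by linarith
  have hR : Finset.Icc ⌈2 * Y⌉₊ ⌊4 * Y⌋₊ ⊆ Finset.Icc 1 ⌊4 * Y⌋₊ :=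
    Finset.Icc_subset_Icc_left (Nat.one_le_iff_ne_zero.2 (Nat.ceil_pos.2 (by linarith)).ne')
  simp_rw [piecePoly_eq_sum_Icc (truncPred p M₂) c hR]
  refine (Literature.NumberTheory.LFunctions.dirichletPolynomial_meanSquare_le _ _ hT).trans ?_
  exact mul_le_mul_of_nonneg_left (sum_norm_sq_coeff_tail_le hY hh₂ p hc hM₂) (by positivity)

/-- The tail's `I`- and `max`-terms: for `0 ≤ T₀ ≤ U ≤ Y`, `∫_{T₀}^{U} |tail|² ≤ 77 h₂/Y` and
`(U/T) ∫_T^{2T} |tail|² ≤ 82 h₂/Y` for `T ≥ U > 0`. [folklore] -/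
theorem tail_bounds {Y h₂ T₀ U : ℝ} (hY : 1 ≤ Y) (hh₂ : 1 ≤ h₂) (p : ℕ → Prop) [DecidablePred p]
    {c : ℕ → ℂ} (hc : ∀ n, ‖c n‖ ≤ 1) {M₂ : ℕ} (hM₂ : (M₂ : ℝ) ≤ 2 * Y + h₂ + 1)
    (hT₀ : 0 ≤ T₀) (hT₀U : T₀ ≤ U) (hU0 : 0 < U) (hUY : U ≤ Y) :
    (∫ t in T₀..U, ‖piecePoly (truncPred p M₂) c (Finset.Icc ⌈2 * Y⌉₊ ⌊4 * Y⌋₊) t‖ ^ 2 ≤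
        77 * (h₂ / Y)) ∧
      ∀ T, U ≤ T → U / T * ∫ t in T..2 * T,
        ‖piecePoly (truncPred p M₂) c (Finset.Icc ⌈2 * Y⌉₊ ⌊4 * Y⌋₊) t‖ ^ 2 ≤ 82 * (h₂ / Y) := by
  have hY0 : 0 < Y := by linarith
  set g : ℝ → ℝ := fun t => ‖piecePoly (truncPred p M₂) c (Finset.Icc ⌈2 * Y⌉₊ ⌊4 * Y⌋₊) t‖ ^ 2
    with hg
  have hgc : Continuous g := continuous_norm_sq_piecePoly _ _ _
  have hg0 : ∀ t, 0 ≤ g t := fun t => by positivity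
  have hfl : ((⌊4 * Y⌋₊ : ℕ) : ℝ) ≤ 4 * Y := Nat.floor_le (by linarith)
  have hMV : ∀ T : ℝ, 0 < T → ∫ t in -T..T, g t ≤ (5 * T + 72 * Y) * (h₂ / Y ^ 2) := by
    intro T hT
    refine (integral_norm_sq_tailPoly_le hY hh₂ p hc hM₂ hT).trans ?_
    exact mul_le_mul_of_nonneg_right (by linarith) (by positivity)
  have hhY : 0 ≤ h₂ / Y ^ 2 := by positivity
  constructor
  · have h1 : ∫ t in T₀..U, g t ≤ ∫ t in -U..U, g t :=
      intervalIntegral.integral_mono_interval (by linarith) hT₀U le_rfl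
        (Eventually.of_forall fun t => hg0 t) (hgc.intervalIntegrable _ _)
    refine h1.trans ((hMV U hU0).trans ?_)
    calc (5 * U + 72 * Y) * (h₂ / Y ^ 2) ≤ (5 * Y + 72 * Y) * (h₂ / Y ^ 2) := by gcongr
      _ = 77 * (h₂ / Y) := by field_simp; ring
  · intro T hT
    have hT0 : 0 < T := hU0.trans_le hT
    have h1 : ∫ t in T..2 * T, g t ≤ ∫ t in -(2 * T)..2 * T, g t :=
      intervalIntegral.integral_mono_interval (by linarith) (by linarith) le_rfl
        (Eventually.of_forall fun t => hg0 t) (hgc.intervalIntegrable _ _)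
    have h2 := hMV (2 * T) (by linarith)
    have hUT0 : 0 ≤ U / T := by positivity
    calc U / T * ∫ t in T..2 * T, g t ≤ U / T * ((5 * (2 * T) + 72 * Y) * (h₂ / Y ^ 2)) :=
          mul_le_mul_of_nonneg_left (h1.trans h2) hUT0
      _ = (10 * U + 72 * Y * (U / T)) * (h₂ / Y ^ 2) := by field_simp; ring
      _ ≤ (10 * Y + 72 * Y * 1) * (h₂ / Y ^ 2) := by
          gcongr
          exact (div_le_one hT0).2 hT
      _ = 82 * (h₂ / Y) := by field_simp; ring

/-! ### The truncated skeleton -/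

/-- **The frequency side of the truncated Parseval bound.**  For the sequence `c 𝟙_p` truncated at
`M₂ = ⌊2Y⌋ + ⌊h₂⌋ + 1`, the two-sided frequency function
`F = |A(1+it)|² + |Ā(1+it)|²` satisfies `∫_{T₀}^{U} F ≤ 12 b + κU` and `(U/T)∫_T^{2T} F ≤ 12 m + κU`
(`U = Y/h`, `κ = 3/(2Y²)`, `b = C₅ (Q/h+1) L + 77 h₂/Y`, `m = C₅ (2Q/h+1) L + 164/h + 82 h₂/Y`),
given the two scale-`Y` piece bounds for `c` and `c̄`. [cite: Lichtman2020, §5, proof of Proposition 3.4, (5.5)–(5.6)] -/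
theorem trunc_frequency_bounds (p : ℕ → Prop) [DecidablePred p] {c : ℕ → ℂ}
    (hc : ∀ n, ‖c n‖ ≤ 1) {Y T₀ h h₂ C₅ Q L : ℝ} (hY : 1 ≤ Y) (hT₀ : 1 ≤ T₀) (hh : 1 ≤ h)
    (hhh₂ : h ≤ h₂) (hC₅ : 0 ≤ C₅) (hQ : 0 ≤ Q) (hL : 0 ≤ L)
    (hT₀U : T₀ ≤ Y / h) (hU : Y ^ (1 / 2 : ℝ) ≤ Y / h)
    (hP₁ : DirichletPieceBound p c Y T₀ C₅ Q L)
    (hP₃ : DirichletPieceBound p (fun n => star (c n)) Y T₀ C₅ Q L) :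
    (∫ t in T₀..Y / h,
        (‖ApolyC Y (fun m => if truncPred p (⌊2 * Y⌋₊ + ⌊h₂⌋₊ + 1) m then c m else 0) t‖ ^ 2
          + ‖ApolyC Y (fun m => star ((fun m => if truncPred p (⌊2 * Y⌋₊ + ⌊h₂⌋₊ + 1) m
              then c m else 0) m)) t‖ ^ 2)
        ≤ 12 * (C₅ * (Q / h + 1) * L + 77 * (h₂ / Y)) + 3 / (2 * Y ^ 2) * (Y / h)) ∧
      ∀ T, Y / h ≤ T → Y / h / T * ∫ t in T..2 * T,
        (‖ApolyC Y (fun m => if truncPred p (⌊2 * Y⌋₊ + ⌊h₂⌋₊ + 1) m then c m else 0) t‖ ^ 2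
          + ‖ApolyC Y (fun m => star ((fun m => if truncPred p (⌊2 * Y⌋₊ + ⌊h₂⌋₊ + 1) m
              then c m else 0) m)) t‖ ^ 2)
        ≤ 12 * (C₅ * (2 * Q / h + 1) * L + 164 / h + 82 * (h₂ / Y)) + 3 / (2 * Y ^ 2) * (Y / h) := by
  have hY0 : 0 < Y := by linarith
  have hh0 : 0 < h := by linarith
  have hT₀0 : 0 ≤ T₀ := by linarith
  have hh₂1 : 1 ≤ h₂ := hh.trans hhh₂
  have hh₂0 : 0 ≤ h₂ := by linarith
  have hU0 : 0 < Y / h := by positivity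
  have hUY : Y / h ≤ Y := div_le_self hY0.le hh
  set M₂ : ℕ := ⌊2 * Y⌋₊ + ⌊h₂⌋₊ + 1 with hM₂def
  have hM₂ : (M₂ : ℝ) ≤ 2 * Y + h₂ + 1 := by
    simp only [hM₂def]; push_cast
    have := Nat.floor_le (by linarith : 0 ≤ 2 * Y)
    have := Nat.floor_le hh₂0
    linarith
  set p' := truncPred p M₂ with hp'
  have hcs : ∀ n, ‖star (c n)‖ ≤ 1 := fun n => by rw [norm_star]; exact hc n
  -- below `⌊2Y⌋` the truncation is invisible
  have h2YM : ∀ m ∈ Finset.Icc ⌈Y⌉₊ ⌊2 * Y⌋₊, m ≤ M₂ := by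
    intro m hm; have := (Finset.mem_Icc.1 hm).2; omega
  have hpiece : ∀ (c' : ℕ → ℂ) (t : ℝ), piecePoly p' c' (Finset.Icc ⌈Y⌉₊ ⌊2 * Y⌋₊) t
      = piecePoly p c' (Finset.Icc ⌈Y⌉₊ ⌊2 * Y⌋₊) t :=
    fun c' t => sum_filter_truncPred_eq p c' h2YM _
  simp only [DirichletPieceBound] at hP₁ hP₃
  -- the majorant `F ≤ 3 (g₁ + tail₁ + g₃ + tail₃) + 3/(2Y²)`
  have estar : (fun m => star ((fun m => if p' m then c m else 0) m))
      = fun m => if p' m then star (c m) else 0 := star_ite_eq p' c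
  have hF : ∀ t, ‖ApolyC Y (fun m => if p' m then c m else 0) t‖ ^ 2
      + ‖ApolyC Y (fun m => star ((fun m => if p' m then c m else 0) m)) t‖ ^ 2
      ≤ 3 * (‖piecePoly p c (Finset.Icc ⌈Y⌉₊ ⌊2 * Y⌋₊) t‖ ^ 2
        + ‖piecePoly p' c (Finset.Icc ⌈2 * Y⌉₊ ⌊4 * Y⌋₊) t‖ ^ 2
        + ‖piecePoly p (fun n => star (c n)) (Finset.Icc ⌈Y⌉₊ ⌊2 * Y⌋₊) t‖ ^ 2
        + ‖piecePoly p' (fun n => star (c n)) (Finset.Icc ⌈2 * Y⌉₊ ⌊4 * Y⌋₊) t‖ ^ 2)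
        + 3 / (2 * Y ^ 2) := by
    intro t
    have h1 := norm_sq_ApolyC_ite_le hY0 p' hc t
    have h2 := norm_sq_ApolyC_ite_le hY0 p' hcs t
    rw [hpiece c t] at h1
    rw [hpiece (fun n => star (c n)) t] at h2
    rw [estar]
    have e : 3 / (2 * Y ^ 2) = 3 * (1 / (4 * Y ^ 2)) + 3 * (1 / (4 * Y ^ 2)) := by
      field_simp; norm_num
    rw [e]
    linarith
  have hFc : Continuous fun t => ‖ApolyC Y (fun m => if p' m then c m else 0) t‖ ^ 2
      + ‖ApolyC Y (fun m => star ((fun m => if p' m then c m else 0) m)) t‖ ^ 2 := by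
    have h1 := continuous_ApolyC Y hY (fun m => if p' m then c m else 0)
    have h2 := continuous_ApolyC Y hY (fun m => star ((fun m => if p' m then c m else 0) m))
    exact ((continuous_norm.comp h1).pow 2).add ((continuous_norm.comp h2).pow 2)
  -- the `I`-bounds: `b = C₅ (Q/h + 1) L + 77 h₂/Y`
  have hQU : Q * (Y / h) / Y = Q / h := by field_simp
  have hb0 : 0 ≤ C₅ * (Q / h + 1) * L := by positivity
  have ht0 : 0 ≤ 77 * (h₂ / Y) := by positivity
  obtain ⟨hIt, hMt⟩ := tail_bounds hY hh₂1 p hc hM₂ hT₀0 hT₀U hU0 hUY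
  obtain ⟨hIt', hMt'⟩ := tail_bounds hY hh₂1 p hcs hM₂ hT₀0 hT₀U hU0 hUY
  have hI1 : ∫ t in T₀..Y / h, ‖piecePoly p c (Finset.Icc ⌈Y⌉₊ ⌊2 * Y⌋₊) t‖ ^ 2 ≤
      C₅ * (Q / h + 1) * L + 77 * (h₂ / Y) := by
    have := hP₁ (Y / h) hU hUY; rw [hQU] at this; linarith
  have hI3 : ∫ t in T₀..Y / h, ‖piecePoly p (fun n => star (c n)) (Finset.Icc ⌈Y⌉₊ ⌊2 * Y⌋₊) t‖ ^ 2 ≤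
      C₅ * (Q / h + 1) * L + 77 * (h₂ / Y) := by
    have := hP₃ (Y / h) hU hUY; rw [hQU] at this; linarith
  have hI2 : ∫ t in T₀..Y / h, ‖piecePoly p' c (Finset.Icc ⌈2 * Y⌉₊ ⌊4 * Y⌋₊) t‖ ^ 2 ≤
      C₅ * (Q / h + 1) * L + 77 * (h₂ / Y) := by linarith
  have hI4 : ∫ t in T₀..Y / h, ‖piecePoly p' (fun n => star (c n)) (Finset.Icc ⌈2 * Y⌉₊ ⌊4 * Y⌋₊) t‖ ^ 2 ≤
      C₅ * (Q / h + 1) * L + 77 * (h₂ / Y) := by linarith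
  -- the tail bounds: `m = C₅ (2Q/h + 1) L + 164/h + 82 h₂/Y`
  have hm0 : 0 ≤ C₅ * (2 * Q / h + 1) * L + 164 / h := by positivity
  have hs0 : 0 ≤ 82 * (h₂ / Y) := by positivity
  have hM1 : ∀ T, Y / h ≤ T → Y / h / T * ∫ t in T..2 * T,
      ‖piecePoly p c (Finset.Icc ⌈Y⌉₊ ⌊2 * Y⌋₊) t‖ ^ 2 ≤
        C₅ * (2 * Q / h + 1) * L + 164 / h + 82 * (h₂ / Y) := by
    intro T hT
    have := piece_tail_scale_one p hc hY hh hC₅ hQ hL hT₀U hU hP₁ hT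
    linarith
  have hM3 : ∀ T, Y / h ≤ T → Y / h / T * ∫ t in T..2 * T,
      ‖piecePoly p (fun n => star (c n)) (Finset.Icc ⌈Y⌉₊ ⌊2 * Y⌋₊) t‖ ^ 2 ≤
        C₅ * (2 * Q / h + 1) * L + 164 / h + 82 * (h₂ / Y) := by
    intro T hT
    have := piece_tail_scale_one p hcs hY hh hC₅ hQ hL hT₀U hU hP₃ hT
    linarith
  have hM2 : ∀ T, Y / h ≤ T → Y / h / T * ∫ t in T..2 * T,
      ‖piecePoly p' c (Finset.Icc ⌈2 * Y⌉₊ ⌊4 * Y⌋₊) t‖ ^ 2 ≤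
        C₅ * (2 * Q / h + 1) * L + 164 / h + 82 * (h₂ / Y) := by
    intro T hT; have := hMt T hT; linarith
  have hM4 : ∀ T, Y / h ≤ T → Y / h / T * ∫ t in T..2 * T,
      ‖piecePoly p' (fun n => star (c n)) (Finset.Icc ⌈2 * Y⌉₊ ⌊4 * Y⌋₊) t‖ ^ 2 ≤
        C₅ * (2 * Q / h + 1) * L + 164 / h + 82 * (h₂ / Y) := by
    intro T hT; have := hMt' T hT; linarith
  -- combine
  have hκ : (0 : ℝ) ≤ 3 / (2 * Y ^ 2) := by positivity
  exact combine_four hκ hT₀0 hT₀U hFc (continuous_norm_sq_piecePoly _ _ _)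
    (continuous_norm_sq_piecePoly _ _ _) (continuous_norm_sq_piecePoly _ _ _)
    (continuous_norm_sq_piecePoly _ _ _) hF hI1 hI2 hI3 hI4 hM1 hM2 hM3 hM4

/-- Numerics of the truncated assembly. [folklore] -/
theorem trunc_numerics {T₀ h h₂ Y C₅ Q L : ℝ} (hh : 1 ≤ h) (hY : 1 ≤ Y) (hT₀ : 1 ≤ T₀)
    (hC₅ : 0 ≤ C₅) (hQ : 0 ≤ Q) (hL : 0 ≤ L) (hh₂0 : 0 ≤ h₂) (hh₂ : h₂ ≤ Y / T₀ ^ 3) :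
    2 / T₀ ^ 2 + (12 * (C₅ * (Q / h + 1) * L + 77 * (h₂ / Y)) + 3 / (2 * Y ^ 2) * (Y / h))
        + (12 * (C₅ * (2 * Q / h + 1) * L + 164 / h + 82 * (h₂ / Y)) + 3 / (2 * Y ^ 2) * (Y / h))
      ≤ 2000 / T₀ ^ 2 + 36 * C₅ * (Q / h + 1) * L + 2000 / h + 4 / Y := by
  have hY0 : 0 < Y := by linarith
  have hsum := pieces_numerics (T₀ := T₀) hh hY hC₅ hQ hL
  have hh₂T : h₂ / Y ≤ 1 / T₀ ^ 2 := by
    rw [div_le_div_iff₀ hY0 (by positivity)]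
    have h1 : h₂ * T₀ ^ 3 ≤ Y := by rwa [← le_div_iff₀ (by positivity)]
    have h2 : T₀ ^ 2 ≤ T₀ ^ 3 := pow_le_pow_right₀ hT₀ (by norm_num)
    nlinarith [mul_le_mul_of_nonneg_left h2 hh₂0]
  have hι : (0 : ℝ) ≤ 1 / T₀ ^ 2 := by positivity
  have hextra : 12 * (77 * (h₂ / Y)) + 12 * (82 * (h₂ / Y)) ≤ 1998 * (1 / T₀ ^ 2) := by linarith
  have e1 : (2000 : ℝ) / T₀ ^ 2 = 2 / T₀ ^ 2 + 1998 * (1 / T₀ ^ 2) := by ring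
  rw [e1]
  linarith

/-- **The analytic skeleton of the proof of Proposition 3.4, truncated form** (p. 14; only the scale
`Y` of Proposition 5.1 is used).  Let `‖c‖ ≤ 1`, `p` a predicate, `Y ≥ 1`, `T₀ ≥ 1`,
`1 ≤ h ≤ h₂ ≤ Y/T₀³`, `U = Y/h` with `T₀ ≤ U` and `√Y ≤ U`.  Assume the long windows are small,
`|∑_{x ≤ m ≤ x+h₂, p(m)} c_m| ≤ η` for `x ∈ [Y, 2Y]`, and the two Proposition-5.1 bounds
`DirichletPieceBound` for `c` and `c̄` at the scale `Y`.  Then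
`∫_Y^{2Y} |∑_{x ≤ m ≤ x+h, p(m)} c_m|² dx
  ≤ 24·2431² h² Y (2000/T₀² + 36 C₅ (Q/h + 1) L + 2000/h + 4/Y) + 2 (h/h₂)² η² Y`.
The sequence fed to the Parseval bound is `c 𝟙_p` truncated at `M₂ = ⌊2Y⌋ + ⌊h₂⌋ + 1 ≥ x + h₂` (its
windows over `x ∈ [Y, 2Y]` are the original ones); its Parseval polynomial is
`G_Y + tail - overlap` (`norm_sq_ApolyC_ite_le` for the truncated predicate), the tail being handled
by Lemma 4.1 alone (`tail_bounds`, `O(h₂/Y) = O(T₀⁻³)`). [cite: Lichtman2020, §5, proof of Proposition 3.4] -/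
theorem meanSquare_le_of_pieces_trunc (p : ℕ → Prop) [DecidablePred p] {c : ℕ → ℂ}
    (hc : ∀ n, ‖c n‖ ≤ 1) {Y T₀ h h₂ η C₅ Q L : ℝ} (hY : 1 ≤ Y) (hT₀ : 1 ≤ T₀) (hh : 1 ≤ h)
    (hhh₂ : h ≤ h₂) (hh₂ : h₂ ≤ Y / T₀ ^ 3) (hη : 0 ≤ η) (hC₅ : 0 ≤ C₅) (hQ : 0 ≤ Q) (hL : 0 ≤ L)
    (hT₀U : T₀ ≤ Y / h) (hU : Y ^ (1 / 2 : ℝ) ≤ Y / h)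
    (hS₂ : ∀ x ∈ Set.Icc Y (2 * Y), ‖∑ m ∈ (Finset.Icc ⌈x⌉₊ ⌊x + h₂⌋₊).filter p, c m‖ ≤ η)
    (hP₁ : DirichletPieceBound p c Y T₀ C₅ Q L)
    (hP₃ : DirichletPieceBound p (fun n => star (c n)) Y T₀ C₅ Q L) :
    ∫ x in Y..2 * Y, ‖∑ m ∈ (Finset.Icc ⌈x⌉₊ ⌊x + h⌋₊).filter p, c m‖ ^ 2 ≤
      24 * 2431 ^ 2 * h ^ 2 * Y * (2000 / T₀ ^ 2 + 36 * C₅ * (Q / h + 1) * L + 2000 / h + 4 / Y)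
        + 2 * (h / h₂) ^ 2 * η ^ 2 * Y := by
  have hY0 : 0 < Y := by linarith
  have hh0 : 0 < h := by linarith
  have hh₂0 : 0 ≤ h₂ := by linarith
  set M₂ : ℕ := ⌊2 * Y⌋₊ + ⌊h₂⌋₊ + 1 with hM₂def
  have hwin : ∀ x ∈ Set.Icc Y (2 * Y), ∀ ℓ : ℝ, 0 ≤ ℓ → ℓ ≤ h₂ →
      ∀ m ∈ Finset.Icc ⌈x⌉₊ ⌊x + ℓ⌋₊, m ≤ M₂ := by
    intro x hx ℓ hℓ0 hℓ m hm
    have h1 : ⌊x + ℓ⌋₊ ≤ ⌊2 * Y + h₂⌋₊ := Nat.floor_mono (by linarith [hx.2])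
    have h2 := floor_add_le_floor_add_floor_add_one (by linarith : 0 ≤ 2 * Y) hh₂0
    have := (Finset.mem_Icc.1 hm).2
    omega
  have ha' : ∀ m, ‖(fun m => if truncPred p M₂ m then c m else 0) m‖ ≤ 1 := fun m => by
    simp only; split_ifs
    · exact hc m
    · simp
  have hfilt : ∀ (R : Finset ℕ), ∑ m ∈ R.filter (truncPred p M₂), c m
      = ∑ m ∈ R, (if truncPred p M₂ m then c m else 0) := fun R => Finset.sum_filter _ _
  obtain ⟨hB, hM⟩ := trunc_frequency_bounds p hc hY hT₀ hh hhh₂ hC₅ hQ hL hT₀U hU hP₁ hP₃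
  -- the windows of the truncated sequence are the original windows
  have hS₂' : ∀ x ∈ Set.Icc Y (2 * Y),
      ‖∑ m ∈ Finset.Icc ⌈x⌉₊ ⌊x + h₂⌋₊, (if truncPred p M₂ m then c m else 0)‖ ≤ η := by
    intro x hx
    rw [← hfilt, sum_filter_truncPred_eq p c (hwin x hx h₂ hh₂0 le_rfl)]
    exact hS₂ x hx
  have main := meanSquare_le_of_parseval ha' hY hT₀ hh hhh₂ hh₂ hη hS₂' hB hM
  have hLHS : ∫ x in Y..2 * Y, ‖∑ m ∈ (Finset.Icc ⌈x⌉₊ ⌊x + h⌋₊).filter p, c m‖ ^ 2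
      = ∫ x in Y..2 * Y, ‖∑ m ∈ Finset.Icc ⌈x⌉₊ ⌊x + h⌋₊, (if truncPred p M₂ m then c m else 0)‖ ^ 2 := by
    refine intervalIntegral.integral_congr fun x hx => ?_
    rw [Set.uIcc_of_le (by linarith)] at hx
    show ‖∑ m ∈ (Finset.Icc ⌈x⌉₊ ⌊x + h⌋₊).filter p, c m‖ ^ 2
      = ‖∑ m ∈ Finset.Icc ⌈x⌉₊ ⌊x + h⌋₊, (if truncPred p M₂ m then c m else 0)‖ ^ 2
    rw [← hfilt, sum_filter_truncPred_eq p c (hwin x hx h hh0.le hhh₂)]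
  rw [hLHS]
  refine main.trans ?_
  have hsum' := trunc_numerics (C₅ := C₅) (Q := Q) (L := L) hh hY hT₀ hC₅ hQ hL hh₂0 hh₂
  have hpre : 0 ≤ 2 * h ^ 2 * Y * (12 * 2431 ^ 2) := by positivity
  have := mul_le_mul_of_nonneg_left hsum' hpre
  linarith

end Lichtman2020

end Literature.NumberTheory.Sieve
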